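import Literature.Probability.RandomPlanarGeometry.SupercriticalSAWPolygons
import Literature.Probability.RandomPlanarGeometry.SAWLists
import HarnessLib

/-!
# Opening a self-avoiding polygon at an edge; splicing a list at a consecutive pair

Two list-level tools for the polygon-insertion surgery of H. Duminil-Copin, G. Kozma, A. Yadin,
*Supercritical self-avoiding walks are space-filling*, Ann. IHP Probab. Stat. 50 (2014), §3
(proof of Proposition 7: "By removing `e` from `S_F` and `[a,b]` from `P_B` and adding the
edges `[x,a]` and `[y,b]`, we obtain a polygon"):

* `pairEdges l` — the consecutive (unordered) pairs of a vertex list, with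
  `pairEdges p.support = p.edges` for Mathlib walks;
* **opening a polygon** (`IsPolygon.exists_open`): a self-avoiding polygon `E`
  (`Literature.Probability.RandomPlanarGeometry.SAW.IsPolygon`, the edge set of a cycle)
  containing the edge `s(a, b)` is traced by a self-avoiding vertex list from `a` to `b` whose
  consecutive pairs are exactly `E ∖ {s(a,b)}` and which has `#E` vertices; `openList` chooses
  one, and `openList` determines `E` (`eq_of_openList_eq`);
* `spliceAt l x y ins` — insert the list `ins` between the consecutive vertices `x, y` of `l`
  (in whichever order they occur, reversing `ins` if `y` comes first), with the decomposition
  lemmas `spliceAt_eq_of_eq_append` / `spliceAt_eq_of_eq_append'`.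

Mathlib: `SimpleGraph.Walk.rotate`, `IsCycle.rotate`, `IsCycle.isPath_takeUntil`,
`IsCycle.isPath_of_append_right`, `Walk.take_spec`, `List.takeWhile_append_dropWhile`.
-/

open Finset

namespace Literature.Probability.RandomPlanarGeometry.SAW

variable {V : Type*}

/-! ### Consecutive pairs of a list -/

/-- The consecutive unordered pairs `s(l₀,l₁), s(l₁,l₂), …` of a list. [folklore] -/
def pairEdges : List V → List (Sym2 V)
  | [] => []
  | [_] => []
  | a :: b :: l => s(a, b) :: pairEdges (b :: l)

/-- `pairEdges` of a list with at least two elements. [folklore] -/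
@[simp] theorem pairEdges_cons_cons (a b : V) (l : List V) :
    pairEdges (a :: b :: l) = s(a, b) :: pairEdges (b :: l) := rfl

/-- `pairEdges` of short lists. [folklore] -/
@[simp] theorem pairEdges_nil : pairEdges ([] : List V) = [] := rfl

/-- `pairEdges` of short lists. [folklore] -/
@[simp] theorem pairEdges_singleton (a : V) : pairEdges [a] = [] := rfl

/-- The number of consecutive pairs. [folklore] -/
theorem length_pairEdges : ∀ l : List V, (pairEdges l).length = l.length - 1
  | [] => rfl
  | [_] => rfl
  | a :: b :: l => by
    rw [pairEdges_cons_cons, List.length_cons, length_pairEdges (b :: l)]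
    simp

/-- The consecutive pairs of the support of a walk are its edges. [folklore] -/
theorem pairEdges_support {G : SimpleGraph V} {u v : V} :
    ∀ p : G.Walk u v, pairEdges p.support = p.edges
  | .nil => rfl
  | .cons h .nil => by simp [pairEdges]
  | .cons h (.cons h' p') => by
    have ih := pairEdges_support (.cons h' p')
    simp only [SimpleGraph.Walk.support_cons, SimpleGraph.Walk.edges_cons] at ih ⊢
    rw [pairEdges_cons_cons, ih]

/-- Membership in `pairEdges`: the pair occurs consecutively. [folklore] -/
theorem mem_pairEdges_iff {l : List V} {e : Sym2 V} :
    e ∈ pairEdges l ↔ ∃ x y, e = s(x, y) ∧ [x, y] <:+: l := by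
  induction l with
  | nil => simp
  | cons a l ih =>
    cases l with
    | nil =>
      simp only [pairEdges_singleton, List.not_mem_nil, false_iff, not_exists, not_and]
      rintro x y - ⟨s, t, h⟩
      have := congrArg List.length h
      simp only [List.length_append, List.length_cons, List.length_nil] at this
      omega
    | cons b l =>
      rw [pairEdges_cons_cons, List.mem_cons, ih]
      constructor
      · rintro (rfl | ⟨x, y, rfl, hxy⟩)
        · exact ⟨a, b, rfl, ⟨[], l, by simp⟩⟩
        · exact ⟨x, y, rfl, by
            obtain ⟨s, t, h⟩ := hxy
            exact ⟨a :: s, t, by rw [← h]; simp⟩⟩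
      · rintro ⟨x, y, rfl, ⟨s, t, h⟩⟩
        cases s with
        | nil =>
          simp only [List.nil_append, List.cons_append, List.cons.injEq] at h
          obtain ⟨rfl, rfl, -⟩ := h
          exact Or.inl rfl
        | cons c s =>
          simp only [List.cons_append, List.cons.injEq] at h
          exact Or.inr ⟨x, y, rfl, ⟨s, t, h.2⟩⟩

/-- Every element of a list with at least two elements lies on a consecutive pair. [folklore] -/
theorem exists_mem_pairEdges_of_mem {l : List V} {w : V} (hw : w ∈ l) (hl : 2 ≤ l.length) :
    ∃ e ∈ pairEdges l, w ∈ e := by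
  have hne : l ≠ [] := List.ne_nil_of_mem hw
  by_cases hh : w = l.head hne
  · match l, hl with
    | a :: b :: l, _ =>
      simp only [List.head_cons] at hh
      subst hh
      exact ⟨s(w, b), by simp, Sym2.mem_mk_left _ _⟩
  · obtain ⟨a, ha⟩ := exists_infix_pair_left hw hne hh
    exact ⟨s(a, w), mem_pairEdges_iff.2 ⟨a, w, rfl, ha⟩, Sym2.mem_mk_right _ _⟩

/-! ### Opening a polygon at an edge -/

section Opening

variable [DecidableEq V] {G : SimpleGraph V}

omit [DecidableEq V] in
/-- A path from `a` to `b` through the edge `s(a, b)` is that single edge. [folklore] -/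
theorem edges_eq_of_isPath_of_mem {a b : V} {p : G.Walk a b} (hp : p.IsPath)
    (h : s(a, b) ∈ p.edges) : p.edges = [s(a, b)] := by
  cases p with
  | nil => simp at h
  | cons hadj p =>
    rename_i w
    rw [SimpleGraph.Walk.cons_isPath_iff] at hp
    rw [SimpleGraph.Walk.edges_cons, List.mem_cons, Sym2.eq_iff] at h
    rcases h with (⟨-, rfl⟩ | ⟨rfl, rfl⟩) | h
    · have : p.Nil := SimpleGraph.Walk.isPath_iff_nil.1 hp.1
      obtain rfl := this.eq_nil
      simp
    · exact absurd rfl hadj.ne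
    · exact absurd (p.fst_mem_support_of_mem_edges h) hp.2

/-- **Opening a polygon at an edge.** A self-avoiding polygon `E` containing the edge
`s(a, b)` is traced by a self-avoiding vertex list from `a` to `b` with `#E` vertices whose
consecutive pairs are exactly the other edges `E ∖ {s(a,b)}` ("removing `[a,b]` from `P_B`"
leaves a self-avoiding path from `a` to `b`). [cite: DuminilCopinKozmaYadin2014, §3 (proof of Proposition 7)] -/
theorem IsPolygon.exists_open {E : Finset (Sym2 V)} (hE : IsPolygon G E) {a b : V}
    (hab : s(a, b) ∈ E) :
    ∃ l : List V, l.IsChain G.Adj ∧ l.Nodup ∧ l.head? = some a ∧ l.getLast? = some b ∧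
      l.length = E.card ∧ 3 ≤ E.card ∧ (pairEdges l).toFinset = E.erase s(a, b) ∧
      s(a, b) ∉ pairEdges l := by
  obtain ⟨u, c, hc, rfl⟩ := hE
  rw [List.mem_toFinset] at hab
  have ha : a ∈ c.support := c.fst_mem_support_of_mem_edges hab
  -- rotate the cycle to start at `a`
  set c' := c.rotate a ha with hc'
  have hcyc : c'.IsCycle := hc.rotate ha
  have hperm : c'.edges.Perm c.edges := (SimpleGraph.Walk.rotate_edges c a ha).perm
  have hE' : c'.edges.toFinset = c.edges.toFinset := List.toFinset_eq_of_perm _ _ hperm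
  have hab' : s(a, b) ∈ c'.edges := hperm.mem_iff.2 hab
  have hne : a ≠ b := G.ne_of_adj (SimpleGraph.Walk.adj_of_mem_edges _ hab)
  have hb : b ∈ c'.support := c'.snd_mem_support_of_mem_edges hab'
  -- split at `b`
  set q₁ := c'.takeUntil b hb
  set q₂ := c'.dropUntil b hb
  have hsplit : q₁.append q₂ = c' := c'.take_spec hb
  have hq₁ : q₁.IsPath := hcyc.isPath_takeUntil hb
  have hq₂ : q₂.IsPath := by
    refine SimpleGraph.Walk.IsCycle.isPath_of_append_right (p := q₁) ?_ (hsplit.symm ▸ hcyc)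
    exact SimpleGraph.Walk.not_nil_of_ne hne
  have hedges : c'.edges = q₁.edges ++ q₂.edges := by
    rw [← SimpleGraph.Walk.edges_append, hsplit]
  have hnodup : (q₁.edges ++ q₂.edges).Nodup := hedges ▸ hcyc.edges_nodup
  have hcard : (c.edges.toFinset).card = c'.length := by
    rw [← hE', List.toFinset_card_of_nodup hcyc.edges_nodup, SimpleGraph.Walk.length_edges]
  have h3 : 3 ≤ c'.length := hcyc.three_le_length
  have h3' : 3 ≤ (c.edges.toFinset).card := hcard ▸ h3
  rw [hedges, List.mem_append] at hab'
  rcases hab' with h₁ | h₂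
  · -- the edge is the whole of `q₁`; the list is `q₂` reversed
    have he : q₁.edges = [s(a, b)] := edges_eq_of_isPath_of_mem hq₁ h₁
    refine ⟨q₂.reverse.support, q₂.reverse.isChain_adj_support,
      (SimpleGraph.Walk.support_reverse _ ▸ List.nodup_reverse.2 hq₂.support_nodup), ?_, ?_,
      ?_, h3', ?_, ?_⟩
    · rw [List.head?_eq_some_head q₂.reverse.support_ne_nil, SimpleGraph.Walk.head_support]
    · rw [List.getLast?_eq_some_getLast q₂.reverse.support_ne_nil,
        SimpleGraph.Walk.getLast_support]
    · rw [SimpleGraph.Walk.length_support, SimpleGraph.Walk.length_reverse, hcard, ← hsplit,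
        SimpleGraph.Walk.length_append, ← SimpleGraph.Walk.length_edges q₁, he]
      simp [add_comm]
    · rw [pairEdges_support, SimpleGraph.Walk.edges_reverse, List.toFinset_reverse, ← hE', hedges,
        he]
      rw [he] at hnodup
      have hnot : s(a, b) ∉ q₂.edges := by
        intro h
        exact (List.nodup_append.1 hnodup).2.2 _ (by simp) _ h rfl
      ext e
      simp only [List.mem_toFinset, Finset.mem_erase, List.mem_append, List.mem_singleton]
      constructor
      · intro h; exact ⟨fun h' => hnot (h' ▸ h), Or.inr h⟩
      · rintro ⟨h, h' | h'⟩
        · exact absurd h' h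
        · exact h'
    · rw [pairEdges_support, SimpleGraph.Walk.edges_reverse, List.mem_reverse]
      intro h
      rw [he] at hnodup
      exact (List.nodup_append.1 hnodup).2.2 _ (by simp) _ h rfl
  · -- the edge is the whole of `q₂`; the list is `q₁`
    have h₂' : s(b, a) ∈ q₂.edges := by rwa [Sym2.eq_swap]
    have he : q₂.edges = [s(b, a)] := edges_eq_of_isPath_of_mem hq₂ h₂'
    have he' : q₂.edges = [s(a, b)] := by rw [he, Sym2.eq_swap]
    refine ⟨q₁.support, q₁.isChain_adj_support, hq₁.support_nodup, ?_, ?_, ?_, h3', ?_, ?_⟩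
    · rw [List.head?_eq_some_head q₁.support_ne_nil, SimpleGraph.Walk.head_support]
    · rw [List.getLast?_eq_some_getLast q₁.support_ne_nil, SimpleGraph.Walk.getLast_support]
    · rw [SimpleGraph.Walk.length_support, hcard, ← hsplit, SimpleGraph.Walk.length_append,
        ← SimpleGraph.Walk.length_edges q₂, he]
      simp
    · rw [pairEdges_support, ← hE', hedges, he']
      rw [he'] at hnodup
      have hnot : s(a, b) ∉ q₁.edges := by
        intro h
        exact (List.nodup_append.1 hnodup).2.2 _ h _ (by simp) rfl
      ext e
      simp only [List.mem_toFinset, Finset.mem_erase, List.mem_append, List.mem_singleton]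
      constructor
      · intro h; exact ⟨fun h' => hnot (h' ▸ h), Or.inl h⟩
      · rintro ⟨h, h' | h'⟩
        · exact h'
        · exact absurd h' h
    · rw [pairEdges_support]
      intro h
      rw [he'] at hnodup
      exact (List.nodup_append.1 hnodup).2.2 _ h _ (by simp) rfl

open Classical in
/-- A chosen opening of the polygon `E` at the edge `s(a, b)`: a self-avoiding vertex list from
`a` to `b` tracing `E ∖ {s(a,b)}` (junk `[]` if `E` is not a polygon through `s(a,b)`).
[cite: DuminilCopinKozmaYadin2014, §3 (proof of Proposition 7)] -/
noncomputable def openList (G : SimpleGraph V) (E : Finset (Sym2 V)) (a b : V) : List V :=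
  if h : IsPolygon G E ∧ s(a, b) ∈ E then Classical.choose (h.1.exists_open h.2) else []

/-- The specification of `openList`. [cite: DuminilCopinKozmaYadin2014, §3 (proof of Proposition 7)] -/
theorem openList_spec {E : Finset (Sym2 V)} (hE : IsPolygon G E) {a b : V} (hab : s(a, b) ∈ E) :
    (openList G E a b).IsChain G.Adj ∧ (openList G E a b).Nodup ∧
      (openList G E a b).head? = some a ∧ (openList G E a b).getLast? = some b ∧
      (openList G E a b).length = E.card ∧ 3 ≤ E.card ∧
      (pairEdges (openList G E a b)).toFinset = E.erase s(a, b) ∧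
      s(a, b) ∉ pairEdges (openList G E a b) := by
  rw [openList, dif_pos ⟨hE, hab⟩]
  exact Classical.choose_spec (hE.exists_open hab)

/-- The polygon is recovered from its opening: `E = {s(a,b)} ∪ pairEdges (openList E a b)`.
[folklore] -/
theorem eq_insert_pairEdges_openList {E : Finset (Sym2 V)} (hE : IsPolygon G E) {a b : V}
    (hab : s(a, b) ∈ E) : E = insert s(a, b) (pairEdges (openList G E a b)).toFinset := by
  rw [(openList_spec hE hab).2.2.2.2.2.2.1, Finset.insert_erase hab]

/-- Opening is injective on polygons through `s(a, b)`. [folklore] -/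
theorem eq_of_openList_eq {E E' : Finset (Sym2 V)} (hE : IsPolygon G E) (hE' : IsPolygon G E')
    {a b : V} (hab : s(a, b) ∈ E) (hab' : s(a, b) ∈ E')
    (h : openList G E a b = openList G E' a b) : E = E' := by
  rw [eq_insert_pairEdges_openList hE hab, eq_insert_pairEdges_openList hE' hab', h]

/-- The other edges of the polygon occur as consecutive pairs of the opening. [folklore] -/
theorem infix_openList_of_mem {E : Finset (Sym2 V)} (hE : IsPolygon G E) {a b x y : V}
    (hab : s(a, b) ∈ E) (hxy : s(x, y) ∈ E) (hne : s(x, y) ≠ s(a, b)) :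
    [x, y] <:+: openList G E a b ∨ [y, x] <:+: openList G E a b := by
  have h := (openList_spec hE hab).2.2.2.2.2.2.1
  have : s(x, y) ∈ (pairEdges (openList G E a b)).toFinset := by
    rw [h]; exact Finset.mem_erase.2 ⟨hne, hxy⟩
  rw [List.mem_toFinset, mem_pairEdges_iff] at this
  obtain ⟨x', y', hxy', hinf⟩ := this
  rcases Sym2.eq_iff.1 hxy' with ⟨rfl, rfl⟩ | ⟨rfl, rfl⟩
  · exact Or.inl hinf
  · exact Or.inr hinf

/-- Every vertex of the opening lies on an edge of the polygon. [folklore] -/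
theorem exists_mem_of_mem_openList {E : Finset (Sym2 V)} (hE : IsPolygon G E) {a b w : V}
    (hab : s(a, b) ∈ E) (hw : w ∈ openList G E a b) : ∃ e ∈ E, w ∈ e := by
  have hspec := openList_spec hE hab
  obtain ⟨e, he, hwe⟩ := exists_mem_pairEdges_of_mem hw (by rw [hspec.2.2.2.2.1]; omega)
  refine ⟨e, ?_, hwe⟩
  have : e ∈ (pairEdges (openList G E a b)).toFinset := List.mem_toFinset.2 he
  rw [hspec.2.2.2.2.2.2.1] at this
  exact Finset.mem_of_mem_erase this

end Opening

/-! ### Splicing at a consecutive pair -/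

section Splice

variable [DecidableEq V]

/-- Insert `ins` between the consecutive elements `x, y` of `l`: if `l = pre ++ x :: y :: post`
the result is `pre ++ x :: ins ++ y :: post`; if `y` precedes `x` the reversed list is
inserted; otherwise `l` is unchanged. [cite: DuminilCopinKozmaYadin2014, §3 (proof of Proposition 7, merging through facing cardinal edges)] -/
def spliceAt (l : List V) (x y : V) (ins : List V) : List V :=
  if [x, y] <:+: l then
    l.takeWhile (fun w => !decide (w = x)) ++ x :: ins ++ (l.dropWhile fun w => !decide (w = x)).tail
  else if [y, x] <:+: l then
    l.takeWhile (fun w => !decide (w = y)) ++ y :: ins.reverse ++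
      (l.dropWhile fun w => !decide (w = y)).tail
  else l

/-- `dropWhile (≠ x)` of `pre ++ x :: rest` with `x ∉ pre`. [folklore] -/
theorem dropWhile_ne_eq {pre rest : List V} {x : V} (hx : x ∉ pre) :
    (pre ++ x :: rest).dropWhile (fun w => !decide (w = x)) = x :: rest := by
  rw [List.dropWhile_append_of_pos (fun a ha => by simp [ne_of_mem_of_not_mem ha hx])]
  simp

/-- `takeWhile (≠ x)` of `pre ++ x :: rest` with `x ∉ pre`. [folklore] -/
theorem takeWhile_ne_eq {pre rest : List V} {x : V} (hx : x ∉ pre) :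
    (pre ++ x :: rest).takeWhile (fun w => !decide (w = x)) = pre :=
  takeWhile_eq_of_append (p := fun w => decide (w = x))
    (fun a ha => by simp [ne_of_mem_of_not_mem ha hx]) (by simp)

/-- Splicing at `x, y` when `x` immediately precedes `y`. [folklore] -/
theorem spliceAt_eq_of_eq_append {l pre post ins : List V} {x y : V} (hl : l.Nodup)
    (h : l = pre ++ x :: y :: post) : spliceAt l x y ins = pre ++ x :: ins ++ y :: post := by
  have hinf : [x, y] <:+: l := ⟨pre, post, by rw [h]; simp⟩
  have hx : x ∉ pre := by
    rw [h, List.nodup_append] at hl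
    exact fun hx => hl.2.2 x hx x (by simp) rfl
  rw [spliceAt, if_pos hinf, h, takeWhile_ne_eq hx, dropWhile_ne_eq hx]
  simp

/-- Splicing at `x, y` when `y` immediately precedes `x`: the reversed list is inserted.
[folklore] -/
theorem spliceAt_eq_of_eq_append' {l pre post ins : List V} {x y : V} (hl : l.Nodup)
    (h : l = pre ++ y :: x :: post) :
    spliceAt l x y ins = pre ++ y :: ins.reverse ++ x :: post := by
  have hinf : [y, x] <:+: l := ⟨pre, post, by rw [h]; simp⟩
  have hnot : ¬ [x, y] <:+: l := by
    rintro ⟨s, t, hst⟩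
    -- `x` would have two different successors
    have e1 : l = (pre ++ [y]) ++ x :: post := by rw [h]; simp
    have e2 : l = s ++ x :: (y :: t) := by rw [← hst]; simp
    obtain ⟨-, rfl⟩ := prefix_unique_of_nodup hl e1 e2
    rw [h, List.nodup_append] at hl
    have := hl.2.1
    simp at this
  have hy : y ∉ pre := by
    rw [h, List.nodup_append] at hl
    exact fun hy => hl.2.2 y hy y (by simp) rfl
  rw [spliceAt, if_neg hnot, if_pos hinf, h, takeWhile_ne_eq hy, dropWhile_ne_eq hy]
  simp

/-- Length of a splice at an existing consecutive pair. [folklore] -/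
theorem length_spliceAt {l ins : List V} {x y : V} (hl : l.Nodup)
    (h : [x, y] <:+: l ∨ [y, x] <:+: l) : (spliceAt l x y ins).length = l.length + ins.length := by
  rcases h with ⟨pre, post, hl'⟩ | ⟨pre, post, hl'⟩
  · have e : l = pre ++ x :: y :: post := by rw [← hl']; simp
    rw [spliceAt_eq_of_eq_append hl e, e]
    simp only [List.length_append, List.length_cons]
    omega
  · have e : l = pre ++ y :: x :: post := by rw [← hl']; simp
    rw [spliceAt_eq_of_eq_append' hl e, e]
    simp only [List.length_append, List.length_cons, List.length_reverse]
    omega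

end Splice

end Literature.Probability.RandomPlanarGeometry.SAW
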